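import Mathlib

/-!
# `BalabanUV.Beta.RelInvTransport` — TRANSPORT OF THE FOUR RELATIVE-INVERSE RULES under a decimation / lift pair, and the
# KKT instance: the marginal of a bordered (constrained-Gaussian) inverse under `Q_N = Q_L·Q_M` is inverted by the bordered
# EFFECTIVE operator `[[H_Mᵀ S H_M, εQ_Lᵀ],[Q_L, 0]] = liftᵀ·[[S, εQ_Nᵀ],[Q_N, 0]]·lift`
# (β sub-cell, lineage an4 gen 33 — the an4 SUPPLIER'S ANSWER, at matrix-certificate level, to row D1's binder «𝕄_j, j ≥ 1»)

HONEST FRAMING (cell charter, verbatim): «discharging `BetaPertH` makes Bałaban's UV stability UNCONDITIONAL — a real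
constructive-QFT result; it is NOT the continuum limit and NOT the Clay problem.»  THIS MODULE is a CELL CERTIFICATE
(pub-balaban β sub-cell, lane an4 = OWNER of `HOME/BINDER-OWNERS.md` row D4, answering row D1's item «(l) j ≥ 1 of rules 3–4 =
an4's step-j effective bordered Hessian (binder 𝕄_j; supplier an4)»): finite-dimensional, kernel-checked identities of matrix
algebra over a commutative ring.  It is NOT a statement of Bałaban's papers, carries no `[cite:]` tag, asserts nothing about the
manuscripts under audit, mints no `Prop` fact and no `def`, instantiates NO binder of the wall and discharges NOTHING of `BetaPertH`
(0 wall binders instantiated; NOT summit progress; NOT continuum; NOT Clay).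

ABSOLUTE RULE (cell, verbatim): «No internally-minted statement may enter as a cited fact. Every hypothesis is either kernel-proved in
this package or a verbatim quotation of a PUBLISHED theorem with page reference. The manuscript(s) under audit are NOT citable for their
own disputed steps — they are the thing under adjudication; programme-internal (2001/route/tribunal) claims are never citable.»  Every
theorem below is kernel-proved from explicit, abstract hypotheses; the records named (row D1 item (l), an2's node RELINV-J0, an5's K1
trio) are LOCATORS for why these identities are wanted, never premises.

WHY.  Row D1's reflection-covariance binder `hR` for the Π_bm-dressed centred spine is the wiring theorem
`SpineRooted.axisReflectionCovariant_flipK_TbalOf_JsBalBmAtOf_ctrC` (an2, p203173) over the four RELATIVE RULES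
`ChartConjugationRelative.RelInv (G_j) (𝕄 j) (E)` — `E∘G = G = G∘E`, `(G∘𝕄)∘E = E`, `(E∘𝕄)∘G = E` — with `G_j := coDressKBmAt ctr Lc
(KInvStep Lc j)` the co-dressed DECIMATED composite resolvent (`KInvStep Lc j = dec (Lc^j) (KInv (Lc^(j+1)))`, `OneStepKernelFamily`) and
`E := axEc ctr Lc`.  At `j = 0` an2 discharged them with `𝕄 0 := bhK Lc`, the undressed bordered Hessian `[[d*d, −𝒬ᵀ],[𝒬, 0]]`
(`RelInvBorderedHessian.relInv_coDressKBmAt_KInv`, which holds at EVERY blocking `N`).  For `j ≥ 1` the resolvent is (the level-`Lc`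
co-dressing of) a DECIMATION `D·K·Dᵀ` — field legs block-averaged by `Lc^j`, multiplier legs read at coarse points — of the
level-`Lc^(j+1)` resolvent `KInv (Lc^(j+1))`, whose CO-DRESSED form has its four rules known at that level (an2, every `N`).  THIS FILE
isolates the algebra that carries the four rules from a fine triple `(K, H, E)` to a decimated triple `(D·K·Dᵀ, H′, E′)`, and identifies
the operator `H′ = 𝕄_j` that does it in the constrained-Gaussian (KKT) instance: NOT a unit-conjugate of the one-step bordered Hessian,
but its conjugate `Uᵀ·H·U` by the LIFT `U` (minimiser extension on field legs, re-indexing on multiplier legs), whose field–field block is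
the EFFECTIVE (Schur-complement, non-local) operator and whose border is the ONE-step constraint — «packed like `bhK`» in shape only.
What the kernel-level assembly must add (the compatibility of decimation/lift with the two dressings and with `axEc`) is named in §2's
hypotheses, not supplied here.

CONTENT (all `[folklore]`; `R` a commutative ring; rectangular `D : m × n`, `U : n × m`).
* §1 RULE ALGEBRA: `compress_rules` (if `H` satisfies rules 3–4 then so does the `E`-compressed `E·H·E`, `E` idempotent),
  **`compressed_unique`** (`E·H·E = E·H′·E` for any two relative inverses of the same `K` on the same `E` — so every supplier of
  `𝕄_j` agrees on `range E`, and every symmetry of `(K, E)` that maps relative inverses to relative inverses fixes `E·𝕄_j·E`),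
  `rules_of_two_sided` (`E = 1`).
* §2 **TRANSPORT** `transport_rules`: from the four rules for `(K, H, E)`, `E` and `E′` symmetric, the compatibilities `E′·D = D·E`,
  `U·E′ = E·U`, `E′·D·U = E′`, and the INTERTWINING `H′·D = Uᵀ·H`, `Dᵀ·H′ = H·U`, the four rules for `(D·K·Dᵀ, H′, E′)`; the two
  one-sided halves `transport_rule3` / `transport_rule4` with exactly the hypotheses each uses; the two-sided shadow
  `transport_left_inverse` / `transport_right_inverse` (`H·K = 1`, `D·U = 1`, `H′·D = Uᵀ·H` ⟹ `H′·(D·K·Dᵀ) = 1`; `K·H = 1`, `D·U = 1`,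
  `Dᵀ·H′ = H·U` ⟹ `(D·K·Dᵀ)·H′ = 1`).
* §3 **THE KKT INSTANCE** (types: fine legs `n`, step legs `m`, multipliers `p`; `S : n × n`, `Q_M : m × n`, `Q_L : p × m`, the composite
  constraint `Q_L·Q_M` — the semigroup law of block averages —, a lift `H_M : n × m` with `Q_M·H_M = 1` and the Euler–Lagrange relation
  `S·H_M = Q_Mᵀ·T`, sign `ε : R` so that `ε = 1` is the symmetric KKT matrix and `ε = −1` an2's packing `[[d*d, −𝒬ᵀ],[𝒬, 0]]`):
  `effective_eq` (`H_Mᵀ·S·H_M = T` — hence `T` symmetric when `S` is, `effective_symm`), **`lift_conj_bordered`**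
  (`Uᵀ·[[S, εQ_Nᵀ],[Q_N, 0]]·U = [[T, εQ_Lᵀ],[Q_L, 0]]` for `U = diag(H_M, 1)`), `dec_mul_lift` (`D·U = 1` for `D = diag(Q_M, 1)`),
  **`bordered_intertwine_left`** (`[[T, εQ_Lᵀ],[Q_L, 0]]·D = Uᵀ·[[S, εQ_Nᵀ],[Q_N, 0]]`, `S`, `T` symmetric),
  **`bordered_intertwine_right`** (`Dᵀ·[[T, εQ_Lᵀ],[Q_L, 0]] = [[S, εQ_Nᵀ],[Q_N, 0]]·U`), and the END
  **`marginal_left_inverse`** / **`marginal_right_inverse`**: for ANY `K` with `[[S, εQ_Nᵀ],[Q_N, 0]]·K = 1` (resp. `K·[[…]] = 1`),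
  `[[T, εQ_Lᵀ],[Q_L, 0]]·(D·K·Dᵀ) = 1` (resp. `(D·K·Dᵀ)·[[T, εQ_Lᵀ],[Q_L, 0]] = 1`) — the marginal (block-averaged field legs,
  unchanged multipliers) of the constrained-Gaussian response at constraint `Q_L·Q_M` IS the response of the EFFECTIVE system at the
  one-step constraint `Q_L`; `marginal_rules_one` (the four rules with `E = 1`, via §2).

READING FOR ROW D1 (owner's words; nothing here is a request or a claim about the tree's infinite-lattice kernels).  With `N = Lc^(j+1)`,
`M = Lc^j`: `𝕄_j := lift_jᵀ ∘ bhK N ∘ lift_j`, `lift_j = (ℋ_M-extension on field legs) ⊕ (coarse re-indexing)`; rules 3–4 for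
`(Π·dec_M(KInv N)·Πᵀ, 𝕄_j, axEc)` follow from an2's rules at blocking `N` by `transport_rules`, whose kernel-level inputs are the two
intertwinings — the Euler–Lagrange + constraint identities of the level-`M` minimiser columns (an5 `ResolventComposition` §2/§6/§8,
`ResolventCompositionStepB.k1_trio`) — and the three projector compatibilities of `dec`/lift with the axial coordinate projectors.
That assembly lives in an2/an5's `MKer` calculus; this file is its letter-level certificate.

RELATION TO THE TREE (no duplication): the four rules as separate matrix hypotheses follow an2's `AssembledJetChartCovarianceRelative`
(§1 there: trace rules; here: compression/uniqueness/transport — disjoint statements); the inverse-free characterisation `Q·H = 1`,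
`S·H = Qᵀ·T` of a constrained minimiser is `B9SectEKernel`'s (`extension_energy`, `constrained_min` — the variational meaning of `T`,
not restated); nothing is imported but Mathlib.  Provenance: b2b-balaban β sub-cell, lineage an4 gen 33, 2026-08-20 (v1).
-/

namespace Summit.QuantumFields.BalabanUV.Beta.RelInvTransport

open Matrix

variable {R : Type*} [CommRing R]
variable {n m p : Type*} [Fintype n] [Fintype m] [Fintype p]

/-! ## §1 Rule algebra: compression and uniqueness of a relative inverse -/

section Rules

variable {K H H' E : Matrix n n R}

/-- [folklore] COMPRESSION: if `H` satisfies rules 3–4 for `(K, E)` (`K·H·E = E`, `E·H·K = E`) with `K·E = K`, `E·K = K` and `E`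
idempotent, then the `E`-compressed operator `E·H·E` satisfies them too. -/
theorem compress_rules (hEK : E * K = K) (hKE : K * E = K) (hKHE : K * H * E = E) (hEHK : E * H * K = E)
    (hE2 : E * E = E) : K * (E * H * E) * E = E ∧ E * (E * H * E) * K = E := by
  constructor
  · calc K * (E * H * E) * E = K * E * H * (E * E) := by simp only [Matrix.mul_assoc]
      _ = E := by rw [hKE, hE2, hKHE]
  · calc E * (E * H * E) * K = E * E * H * (E * K) := by simp only [Matrix.mul_assoc]
      _ = E := by rw [hE2, hEK, hEHK]

/-- [folklore] **UNIQUENESS OF THE COMPRESSED RELATIVE INVERSE**: two operators `H`, `H′` satisfying rule 4 resp. rule 3 for the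
same `(K, E)` have the same `E`-compression: `E·H·E = E·H′·E`.  (Proof: `E·H′·E = (E·H·K)·H′·E = E·H·(K·H′·E) = E·H·E`.)  So every
supplier of a relative inverse agrees on `range E`. -/
theorem compressed_unique (hEHK : E * H * K = E) (hKH'E : K * H' * E = E) : E * H * E = E * H' * E := by
  calc E * H * E = E * H * (K * H' * E) := by rw [hKH'E]
    _ = E * H * K * H' * E := by simp only [Matrix.mul_assoc]
    _ = E * H' * E := by rw [hEHK]

/-- [folklore] Consequence of uniqueness: a map `σ` on matrices that FIXES `E·H·E` whenever it sends a relative inverse `H` of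
`(K, E)` to another relative inverse of `(K, E)` — stated as: if `σ H` again satisfies rule 3, then `E·H·E = E·(σ H)·E`. -/
theorem compressed_invariant (σ : Matrix n n R → Matrix n n R) (hEHK : E * H * K = E) (hσ : K * σ H * E = E) :
    E * H * E = E * σ H * E :=
  compressed_unique hEHK hσ

/-- [folklore] A two-sided inverse satisfies the four rules with `E = 1`. -/
theorem rules_of_two_sided [DecidableEq n] (hHK : H * K = 1) (hKH : K * H = 1) :
    (1 : Matrix n n R) * K = K ∧ K * 1 = K ∧ K * H * 1 = 1 ∧ 1 * H * K = 1 := by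
  refine ⟨Matrix.one_mul K, Matrix.mul_one K, ?_, ?_⟩
  · rw [Matrix.mul_one, hKH]
  · rw [Matrix.one_mul, hHK]

end Rules

/-! ## §2 Transport of the four rules under a decimation / lift pair -/

section Transport

variable {K H E : Matrix n n R} {H' E' : Matrix m m R} {D : Matrix m n R} {U : Matrix n m R}

/-- [folklore] Transposed compatibility: from `E′·D = D·E` and `E`, `E′` symmetric, `Dᵀ·E′ = E·Dᵀ`. -/
theorem transpose_compat (hEt : Eᵀ = E) (hE't : E'ᵀ = E') (hDE : E' * D = D * E) : Dᵀ * E' = E * Dᵀ := by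
  have h := congrArg Matrix.transpose hDE
  rw [Matrix.transpose_mul, Matrix.transpose_mul, hEt, hE't] at h
  exact h

/-- [folklore] Transposed compatibility: from `U·E′ = E·U` and `E`, `E′` symmetric, `E′·Uᵀ = Uᵀ·E`. -/
theorem transpose_compat' (hEt : Eᵀ = E) (hE't : E'ᵀ = E') (hUE : U * E' = E * U) : E' * Uᵀ = Uᵀ * E := by
  have h := congrArg Matrix.transpose hUE
  rw [Matrix.transpose_mul, Matrix.transpose_mul, hEt, hE't] at h
  exact h

/-- [folklore] RULE 1 transported: `E′·(D·K·Dᵀ) = D·K·Dᵀ` from `E·K = K` and `E′·D = D·E`. -/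
theorem transport_rule1 (hEK : E * K = K) (hDE : E' * D = D * E) : E' * (D * K * Dᵀ) = D * K * Dᵀ := by
  calc E' * (D * K * Dᵀ) = E' * D * K * Dᵀ := by simp only [Matrix.mul_assoc]
    _ = D * (E * K) * Dᵀ := by rw [hDE]; simp only [Matrix.mul_assoc]
    _ = D * K * Dᵀ := by rw [hEK]

/-- [folklore] RULE 2 transported: `(D·K·Dᵀ)·E′ = D·K·Dᵀ` from `K·E = K` and `Dᵀ·E′ = E·Dᵀ`. -/
theorem transport_rule2 (hKE : K * E = K) (hDE' : Dᵀ * E' = E * Dᵀ) : D * K * Dᵀ * E' = D * K * Dᵀ := by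
  calc D * K * Dᵀ * E' = D * K * (Dᵀ * E') := by simp only [Matrix.mul_assoc]
    _ = D * (K * E) * Dᵀ := by rw [hDE']; simp only [Matrix.mul_assoc]
    _ = D * K * Dᵀ := by rw [hKE]

/-- [folklore] RULE 3 transported: `(D·K·Dᵀ)·H′·E′ = E′` from `K·H·E = E`, the intertwining `Dᵀ·H′ = H·U`, the compatibility
`U·E′ = E·U`, `E′·D = D·E` and `E′·D·U = E′`. -/
theorem transport_rule3 (hKHE : K * H * E = E) (hDH' : Dᵀ * H' = H * U) (hUE : U * E' = E * U) (hDE : E' * D = D * E)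
    (hDU : E' * D * U = E') : D * K * Dᵀ * H' * E' = E' := by
  calc D * K * Dᵀ * H' * E' = D * K * (Dᵀ * H') * E' := by simp only [Matrix.mul_assoc]
    _ = D * K * (H * U) * E' := by rw [hDH']
    _ = D * K * H * (U * E') := by simp only [Matrix.mul_assoc]
    _ = D * (K * H * E) * U := by rw [hUE]; simp only [Matrix.mul_assoc]
    _ = D * E * U := by rw [hKHE]
    _ = E' * D * U := by rw [← hDE]
    _ = E' := hDU

/-- [folklore] RULE 4 transported: `E′·H′·(D·K·Dᵀ) = E′` from `E·H·K = E`, the intertwining `H′·D = Uᵀ·H`, the compatibility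
`E′·Uᵀ = Uᵀ·E`, `Dᵀ·E′ = E·Dᵀ` and `Uᵀ·Dᵀ·E′ = E′`. -/
theorem transport_rule4 (hEHK : E * H * K = E) (hH'D : H' * D = Uᵀ * H) (hUE' : E' * Uᵀ = Uᵀ * E) (hDE' : Dᵀ * E' = E * Dᵀ)
    (hUD : Uᵀ * Dᵀ * E' = E') : E' * H' * (D * K * Dᵀ) = E' := by
  calc E' * H' * (D * K * Dᵀ) = E' * (H' * D) * K * Dᵀ := by simp only [Matrix.mul_assoc]
    _ = E' * (Uᵀ * H) * K * Dᵀ := by rw [hH'D]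
    _ = E' * Uᵀ * H * K * Dᵀ := by simp only [Matrix.mul_assoc]
    _ = Uᵀ * (E * H * K) * Dᵀ := by rw [hUE']; simp only [Matrix.mul_assoc]
    _ = Uᵀ * (E * Dᵀ) := by rw [hEHK]; simp only [Matrix.mul_assoc]
    _ = Uᵀ * Dᵀ * E' := by rw [← hDE']; simp only [Matrix.mul_assoc]
    _ = E' := hUD

/-- [folklore] **TRANSPORT OF THE FOUR RELATIVE RULES.**  Fine level: `E·K = K`, `K·E = K`, `K·H·E = E`, `E·H·K = E`; projectors
`E`, `E′` symmetric; compatibilities `E′·D = D·E`, `U·E′ = E·U`, `E′·D·U = E′`; intertwining `H′·D = Uᵀ·H`, `Dᵀ·H′ = H·U`.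
Conclusion: the four rules for the DECIMATED triple `(D·K·Dᵀ, H′, E′)`, in the conjunct order of `ChartConjugationRelative.RelInv`
(EA, AE, AME = rule 3, EMA = rule 4). -/
theorem transport_rules (hEK : E * K = K) (hKE : K * E = K) (hKHE : K * H * E = E) (hEHK : E * H * K = E)
    (hEt : Eᵀ = E) (hE't : E'ᵀ = E') (hDE : E' * D = D * E) (hUE : U * E' = E * U) (hDU : E' * D * U = E')
    (hH'D : H' * D = Uᵀ * H) (hDH' : Dᵀ * H' = H * U) :
    E' * (D * K * Dᵀ) = D * K * Dᵀ ∧ D * K * Dᵀ * E' = D * K * Dᵀ ∧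
      D * K * Dᵀ * H' * E' = E' ∧ E' * H' * (D * K * Dᵀ) = E' := by
  have hDE' : Dᵀ * E' = E * Dᵀ := transpose_compat hEt hE't hDE
  have hUE' : E' * Uᵀ = Uᵀ * E := transpose_compat' hEt hE't hUE
  have hUD : Uᵀ * Dᵀ * E' = E' := by
    have h := congrArg Matrix.transpose hDU
    rw [Matrix.transpose_mul, Matrix.transpose_mul, hE't, ← Matrix.mul_assoc] at h
    exact h
  exact ⟨transport_rule1 hEK hDE, transport_rule2 hKE hDE', transport_rule3 hKHE hDH' hUE hDE hDU,
    transport_rule4 hEHK hH'D hUE' hDE' hUD⟩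

/-- [folklore] TWO-SIDED SHADOW, left: `H·K = 1`, `D·U = 1`, `H′·D = Uᵀ·H` ⟹ `H′·(D·K·Dᵀ) = 1`. -/
theorem transport_left_inverse [DecidableEq n] [DecidableEq m] (hHK : H * K = 1) (hDU : D * U = 1) (hH'D : H' * D = Uᵀ * H) :
    H' * (D * K * Dᵀ) = 1 := by
  calc H' * (D * K * Dᵀ) = H' * D * K * Dᵀ := by simp only [Matrix.mul_assoc]
    _ = Uᵀ * (H * K) * Dᵀ := by rw [hH'D]; simp only [Matrix.mul_assoc]
    _ = (D * U)ᵀ := by rw [hHK, Matrix.mul_one, Matrix.transpose_mul]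
    _ = 1 := by rw [hDU, Matrix.transpose_one]

/-- [folklore] TWO-SIDED SHADOW, right: `K·H = 1`, `D·U = 1`, `Dᵀ·H′ = H·U` ⟹ `(D·K·Dᵀ)·H′ = 1`. -/
theorem transport_right_inverse [DecidableEq n] [DecidableEq m] (hKH : K * H = 1) (hDU : D * U = 1) (hDH' : Dᵀ * H' = H * U) :
    D * K * Dᵀ * H' = 1 := by
  calc D * K * Dᵀ * H' = D * K * (Dᵀ * H') := by simp only [Matrix.mul_assoc]
    _ = D * (K * H) * U := by rw [hDH']; simp only [Matrix.mul_assoc]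
    _ = 1 := by rw [hKH, Matrix.mul_one, hDU]

end Transport

/-! ## §3 The KKT instance: bordered Hessian, decimation by `Q_M`, lift by the minimiser `H_M`, effective operator `T` -/

section KKT

variable [DecidableEq n] [DecidableEq m] [DecidableEq p]
variable (S : Matrix n n R) (QM : Matrix m n R) (QL : Matrix p m R) (HM : Matrix n m R) (T : Matrix m m R) (ε : R)

omit [DecidableEq n] [DecidableEq p] in
/-- [folklore] The effective operator: from the Euler–Lagrange relation `S·H_M = Q_Mᵀ·T` and the constraint `Q_M·H_M = 1`,
`H_Mᵀ·S·H_M = T` (inverse-free; cf. `B9SectEKernel.extension_energy` for its variational meaning). -/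
theorem effective_eq (hQH : QM * HM = 1) (hSH : S * HM = QMᵀ * T) : HMᵀ * S * HM = T := by
  calc HMᵀ * S * HM = HMᵀ * (S * HM) := Matrix.mul_assoc _ _ _
    _ = (QM * HM)ᵀ * T := by rw [hSH, ← Matrix.mul_assoc, ← Matrix.transpose_mul]
    _ = T := by rw [hQH, Matrix.transpose_one, Matrix.one_mul]

omit [DecidableEq n] [DecidableEq p] in
/-- [folklore] The effective operator is symmetric when `S` is. -/
theorem effective_symm (hS : Sᵀ = S) (hQH : QM * HM = 1) (hSH : S * HM = QMᵀ * T) : Tᵀ = T := by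
  rw [← effective_eq S QM HM T hQH hSH]
  simp only [Matrix.transpose_mul, Matrix.transpose_transpose, hS, Matrix.mul_assoc]

omit [DecidableEq n] [DecidableEq m] [DecidableEq p] in
/-- [folklore] `H_Mᵀ·S = T·Q_M` (transpose of the Euler–Lagrange relation, `S` and `T` symmetric). -/
theorem lift_transpose_mul_S (hS : Sᵀ = S) (hT : Tᵀ = T) (hSH : S * HM = QMᵀ * T) : HMᵀ * S = T * QM := by
  have h := congrArg Matrix.transpose hSH
  rw [Matrix.transpose_mul, Matrix.transpose_mul, Matrix.transpose_transpose, hS, hT] at h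
  exact h

omit [Fintype m] [DecidableEq n] in
/-- [folklore] **DECIMATION ∘ LIFT = 1**: `diag(Q_M, 1)·diag(H_M, 1) = 1` from `Q_M·H_M = 1`. -/
theorem dec_mul_lift (hQH : QM * HM = 1) :
    fromBlocks QM 0 0 (1 : Matrix p p R) * fromBlocks HM 0 0 (1 : Matrix p p R) = 1 := by
  rw [Matrix.fromBlocks_multiply]
  simp [hQH]

omit [DecidableEq n] in
/-- [folklore] **THE MARGINAL BORDERED OPERATOR IS THE LIFT-CONJUGATE OF THE FINE ONE**:
`diag(H_M, 1)ᵀ·[[S, εQ_Nᵀ],[Q_N, 0]]·diag(H_M, 1) = [[T, εQ_Lᵀ],[Q_L, 0]]` with `Q_N = Q_L·Q_M` — field block the EFFECTIVE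
operator `T = H_MᵀSH_M`, border the ONE-step constraint `Q_L`, zero corner. -/
theorem lift_conj_bordered (hQH : QM * HM = 1) (hSH : S * HM = QMᵀ * T) :
    (fromBlocks HM 0 0 (1 : Matrix p p R))ᵀ * fromBlocks S (ε • (QL * QM)ᵀ) (QL * QM) 0 *
        fromBlocks HM 0 0 (1 : Matrix p p R) =
      fromBlocks T (ε • QLᵀ) QL 0 := by
  have hT : HMᵀ * S * HM = T := effective_eq S QM HM T hQH hSH
  have h1 : HMᵀ * (QL * QM)ᵀ = QLᵀ := by
    rw [Matrix.transpose_mul, ← Matrix.mul_assoc, ← Matrix.transpose_mul, hQH, Matrix.transpose_one, Matrix.one_mul]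
  have h2 : QL * QM * HM = QL := by rw [Matrix.mul_assoc, hQH, Matrix.mul_one]
  rw [Matrix.fromBlocks_transpose, Matrix.fromBlocks_multiply, Matrix.fromBlocks_multiply]
  simp only [Matrix.transpose_zero, Matrix.transpose_one, Matrix.zero_mul, Matrix.mul_zero, add_zero, zero_add,
    Matrix.one_mul, Matrix.mul_one, Matrix.mul_smul, smul_zero]
  rw [hT, h1, h2]

omit [DecidableEq n] in
/-- [folklore] **LEFT INTERTWINING**: `[[T, εQ_Lᵀ],[Q_L, 0]]·diag(Q_M, 1) = diag(H_M, 1)ᵀ·[[S, εQ_Nᵀ],[Q_N, 0]]` (`S`, `T`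
symmetric; uses `H_MᵀS = TQ_M` and `Q_M·H_M = 1`). -/
theorem bordered_intertwine_left (hS : Sᵀ = S) (hT : Tᵀ = T) (hQH : QM * HM = 1) (hSH : S * HM = QMᵀ * T) :
    fromBlocks T (ε • QLᵀ) QL 0 * fromBlocks QM 0 0 (1 : Matrix p p R) =
      (fromBlocks HM 0 0 (1 : Matrix p p R))ᵀ * fromBlocks S (ε • (QL * QM)ᵀ) (QL * QM) 0 := by
  have hL : HMᵀ * S = T * QM := lift_transpose_mul_S S QM HM T hS hT hSH
  have h1 : HMᵀ * (QL * QM)ᵀ = QLᵀ := by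
    rw [Matrix.transpose_mul, ← Matrix.mul_assoc, ← Matrix.transpose_mul, hQH, Matrix.transpose_one, Matrix.one_mul]
  rw [Matrix.fromBlocks_transpose, Matrix.fromBlocks_multiply, Matrix.fromBlocks_multiply]
  simp only [Matrix.transpose_zero, Matrix.transpose_one, Matrix.zero_mul, Matrix.mul_zero, add_zero, zero_add,
    Matrix.one_mul, Matrix.mul_one, Matrix.mul_smul, smul_zero]
  rw [hL, h1]

omit [DecidableEq n] in
/-- [folklore] **RIGHT INTERTWINING**: `diag(Q_M, 1)ᵀ·[[T, εQ_Lᵀ],[Q_L, 0]] = [[S, εQ_Nᵀ],[Q_N, 0]]·diag(H_M, 1)` (uses only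
`S·H_M = Q_MᵀT` and `Q_M·H_M = 1`; no symmetry). -/
theorem bordered_intertwine_right (hQH : QM * HM = 1) (hSH : S * HM = QMᵀ * T) :
    (fromBlocks QM 0 0 (1 : Matrix p p R))ᵀ * fromBlocks T (ε • QLᵀ) QL 0 =
      fromBlocks S (ε • (QL * QM)ᵀ) (QL * QM) 0 * fromBlocks HM 0 0 (1 : Matrix p p R) := by
  have h2 : QL * QM * HM = QL := by rw [Matrix.mul_assoc, hQH, Matrix.mul_one]
  rw [Matrix.fromBlocks_transpose, Matrix.fromBlocks_multiply, Matrix.fromBlocks_multiply]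
  simp only [Matrix.transpose_zero, Matrix.transpose_one, Matrix.zero_mul, Matrix.mul_zero, add_zero, zero_add,
    Matrix.one_mul, Matrix.mul_one, Matrix.mul_smul, Matrix.transpose_mul, smul_zero]
  rw [hSH, h2]

/-- [folklore] **END, LEFT: THE MARGINAL OF A BORDERED INVERSE IS INVERTED BY THE BORDERED EFFECTIVE OPERATOR.**  For ANY `K`
with `[[S, εQ_Nᵀ],[Q_N, 0]]·K = 1` (`Q_N = Q_L·Q_M`; `S`, `T` symmetric; `Q_M·H_M = 1`, `S·H_M = Q_MᵀT`):
`[[T, εQ_Lᵀ],[Q_L, 0]]·(D·K·Dᵀ) = 1`, `D = diag(Q_M, 1)`. -/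
theorem marginal_left_inverse (hS : Sᵀ = S) (hT : Tᵀ = T) (hQH : QM * HM = 1) (hSH : S * HM = QMᵀ * T)
    (K : Matrix (n ⊕ p) (n ⊕ p) R) (hHK : fromBlocks S (ε • (QL * QM)ᵀ) (QL * QM) 0 * K = 1) :
    fromBlocks T (ε • QLᵀ) QL 0 *
        (fromBlocks QM 0 0 (1 : Matrix p p R) * K * (fromBlocks QM 0 0 (1 : Matrix p p R))ᵀ) = 1 :=
  transport_left_inverse hHK (dec_mul_lift QM HM hQH) (bordered_intertwine_left S QM QL HM T ε hS hT hQH hSH)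

/-- [folklore] **END, RIGHT**: for ANY `K` with `K·[[S, εQ_Nᵀ],[Q_N, 0]] = 1`, `(D·K·Dᵀ)·[[T, εQ_Lᵀ],[Q_L, 0]] = 1`. -/
theorem marginal_right_inverse (hQH : QM * HM = 1) (hSH : S * HM = QMᵀ * T)
    (K : Matrix (n ⊕ p) (n ⊕ p) R) (hKH : K * fromBlocks S (ε • (QL * QM)ᵀ) (QL * QM) 0 = 1) :
    fromBlocks QM 0 0 (1 : Matrix p p R) * K * (fromBlocks QM 0 0 (1 : Matrix p p R))ᵀ *
        fromBlocks T (ε • QLᵀ) QL 0 = 1 :=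
  transport_right_inverse hKH (dec_mul_lift QM HM hQH) (bordered_intertwine_right S QM QL HM T ε hQH hSH)

/-- [folklore] Over a commutative ring a one-sided inverse of a square matrix is two-sided: from the LEFT end alone,
`(D·K·Dᵀ)·[[T, εQ_Lᵀ],[Q_L, 0]] = 1` as well. -/
theorem marginal_right_inverse' (hS : Sᵀ = S) (hT : Tᵀ = T) (hQH : QM * HM = 1) (hSH : S * HM = QMᵀ * T)
    (K : Matrix (n ⊕ p) (n ⊕ p) R) (hHK : fromBlocks S (ε • (QL * QM)ᵀ) (QL * QM) 0 * K = 1) :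
    fromBlocks QM 0 0 (1 : Matrix p p R) * K * (fromBlocks QM 0 0 (1 : Matrix p p R))ᵀ *
        fromBlocks T (ε • QLᵀ) QL 0 = 1 :=
  mul_eq_one_comm.1 (marginal_left_inverse S QM QL HM T ε hS hT hQH hSH K hHK)

/-- [folklore] The four relative rules with `E = 1` for the marginal, obtained through §2's `transport_rules` (consistency of the
two routes): fine rules with `E = 1` from `H·K = 1 = K·H`, compatibilities trivial, intertwinings from §3. -/
theorem marginal_rules_one (hS : Sᵀ = S) (hT : Tᵀ = T) (hQH : QM * HM = 1) (hSH : S * HM = QMᵀ * T)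
    (K : Matrix (n ⊕ p) (n ⊕ p) R) (hHK : fromBlocks S (ε • (QL * QM)ᵀ) (QL * QM) 0 * K = 1)
    (hKH : K * fromBlocks S (ε • (QL * QM)ᵀ) (QL * QM) 0 = 1) :
    let D := fromBlocks QM 0 0 (1 : Matrix p p R)
    let H' := fromBlocks T (ε • QLᵀ) QL 0
    (1 : Matrix (m ⊕ p) (m ⊕ p) R) * (D * K * Dᵀ) = D * K * Dᵀ ∧ D * K * Dᵀ * 1 = D * K * Dᵀ ∧
      D * K * Dᵀ * H' * 1 = 1 ∧ 1 * H' * (D * K * Dᵀ) = 1 := by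
  intro D H'
  have h4 := rules_of_two_sided (H := fromBlocks S (ε • (QL * QM)ᵀ) (QL * QM) 0) hHK hKH
  refine transport_rules (E := 1) (E' := 1) (U := fromBlocks HM 0 0 (1 : Matrix p p R)) h4.1 h4.2.1 h4.2.2.1 h4.2.2.2
    Matrix.transpose_one Matrix.transpose_one ?_ ?_ ?_ ?_ ?_
  · rw [Matrix.one_mul, Matrix.mul_one]
  · rw [Matrix.one_mul, Matrix.mul_one]
  · rw [Matrix.one_mul, dec_mul_lift QM HM hQH]
  · exact bordered_intertwine_left S QM QL HM T ε hS hT hQH hSH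
  · exact bordered_intertwine_right S QM QL HM T ε hQH hSH

end KKT

end Summit.QuantumFields.BalabanUV.Beta.RelInvTransport
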